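import Summits.KontsevichZagierPeriods.KontsevichZagierPeriods.Theorems.TorsionLogsOneThirdPeriod
import Summits.KontsevichZagierPeriods.KontsevichZagierPeriods.Theorems.TorsionLogsGKZLevelThreePairBetaCubic
import Summits.KontsevichZagierPeriods.KontsevichZagierPeriods.Theorems.FermatIsogenyBetaLinearSectorSixthsStubIsogenyPos
import HarnessLib

/-!
# `BetaLinearSector` (stmt-KontsevichZagierPeriods-3897), line `fermat-sector-transport` — stub `stub_isogenyThree_piece_mid`

The LEVEL-6 rung of the crux `BetaLinearSector` (route FermatIsogeny) needs the CM coincidence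
`B(1/6,1/2) = √3·B(1/3,1/2)` INSIDE the Kontsevich–Zagier calculus of moves (`KZ.Equivalent`). It is
realised by the REAL 3-ISOGENY `ψ : {y² = x³ + 1} → {Y² = X³ − 1}` with the `ℚ`-rational `x`-map

  `X(x) = (x³ + 4)/(3x²)`, `X′(x) = (x³ − 8)/(3x³)`, `ψ^*(dX/Y) = √3·dx/y`,

whose algebra is the identity `(x³ + 4)³ − 27x⁶ = (x³ + 1)(x³ − 8)²`, i.e.
`X³ − 1 = (x³ + 1)(x³ − 8)²/(27x⁶)` (`isoPos_isogeny_identity` and the derivative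
`isoPos_hasDerivAt_xMap` are reused from the arc `(2, ∞)`,
`FermatIsogenyBetaLinearSectorSixthsStubIsogenyPos.lean`). This file is the MIDDLE arc `(0, 2)` of
the chain: there `x³ − 8 < 0 < x³`, so `X′ < 0`, `X → +∞` as `x → 0⁺` and `X(2) = 1`; `X` maps
`(0, 2)` bijectively (decreasingly) onto `(1, ∞)`, and on `(0, 2)`
`√(X³ − 1) = √(x³+1)·(8 − x³)/(3√3·x³)`, whence the rule-(2) Jacobian identity

  `(1/√(X(x)³ − 1))·|X′(x)| = [3√3x³/(√(x³+1)(8 − x³))]·(8 − x³)/(3x³) = √3/√(x³ + 1)`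

(`isoMid_jacobian`). Hence for `S = [(0,2), √3/√(x³+1)]` and `T = [(1,∞), 1/√(x³−1)]` (integrands
prescribed on the domains only) `[S] − [T]` is ONE change-of-variables move
(`stub_isogenyThree_piece_mid`). The packaging in `ℝ¹` is
`Summit.KontsevichZagierPeriods.HermiteRigidity.CMTwistQuasiPeriodTransfer.of_sub_of_mem_changeOfVariablesRel_dimOne`
and `GKZLevelThree.isSemialgebraicFunOn_ratFun₁`; the structure follows
`Summit.KontsevichZagierPeriods.TorsionLogs.OneThirdPeriod.arc_cov` (same curve, the doubling map).

References: M. Kontsevich, D. Zagier, *Periods* (2001), §1.2 rule (2); J. H. Silverman,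
*The Arithmetic of Elliptic Curves* (2009), III.4 (isogenies; Vélu's formulae for the 3-isogeny
with kernel the flexes `(0, ±1)` of `y² = x³ + 1`).
-/

noncomputable section

namespace Summit.KontsevichZagierPeriods.FermatIsogeny.BetaLinearSector.Sixths

open Set MeasureTheory
open MvPolynomial (aeval X C)
open Literature.NumberTheory.Transcendental
open Summit.KontsevichZagierPeriods.HermiteRigidity.CMTwistQuasiPeriodTransfer
  (of_sub_of_mem_changeOfVariablesRel_dimOne)
open Summit.KontsevichZagierPeriods.KontsevichZagierPeriods.Theorems.GKZLevelThree
  (isSemialgebraicFunOn_ratFun₁)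

/-! ## Real algebra of the 3-isogeny `x`-map `X(x) = (x³ + 4)/(3x²)` on the arc `(0, 2)` -/

/-- On `(0, 2)`: `x³ < 8`. [folklore] -/
theorem isoMid_cube_lt_eight {x : ℝ} (h1 : 0 < x) (h2 : x < 2) : x ^ 3 < 8 := by
  have h := pow_lt_pow_left₀ h2 h1.le (by norm_num : (3:ℕ) ≠ 0)
  norm_num at h
  exact h

/-- `X > 1` on `(0, 2)`: `X(x) − 1 = (x + 1)(x − 2)²/(3x²)`. [folklore] -/
theorem isoMid_one_lt_phi {x : ℝ} (h1 : 0 < x) (h2 : x < 2) :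
    1 < (x ^ 3 + 4) / (3 * x ^ 2) := by
  rw [lt_div_iff₀ (by positivity)]
  nlinarith [mul_pos (by linarith : (0:ℝ) < x + 1) (pow_pos (by linarith : (0:ℝ) < 2 - x) 2)]

/-- `X(x)³ − 1 = (√(x³+1)·(8 − x³)/(3√3·x³))²` for `0 < x` (the 3-isogeny identity divided by
`27x⁶`, `27 = (3√3)²`). [cite: SilvermanAEC2009, III.4] -/
theorem isoMid_phi_cube_sub_one {x : ℝ} (h1 : 0 < x) :
    ((x ^ 3 + 4) / (3 * x ^ 2)) ^ 3 - 1 =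
      (Real.sqrt (x ^ 3 + 1) * (8 - x ^ 3) / (3 * Real.sqrt 3 * x ^ 3)) ^ 2 := by
  have h3 : 0 < x ^ 3 + 1 := by positivity
  have hs2 : Real.sqrt (x ^ 3 + 1) ^ 2 = x ^ 3 + 1 := Real.sq_sqrt h3.le
  have ht2 : Real.sqrt 3 ^ 2 = 3 := Real.sq_sqrt (by norm_num)
  have hx : x ≠ 0 := h1.ne'
  have hid : (x ^ 3 + 4) ^ 3 = (x ^ 3 + 1) * (x ^ 3 - 8) ^ 2 + 27 * x ^ 6 := by
    linarith [isoPos_isogeny_identity x]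
  simp only [div_pow, mul_pow, hs2, ht2, hid]
  field_simp
  ring

/-- **The rule-2 integrand identity** `√3/√(x³ + 1) = (1/√(X(x)³ − 1))·|X′(x)|` on `(0, 2)`.
[cite: KontsevichZagier2001, §1.2 rule (2)] -/
theorem isoMid_jacobian {x : ℝ} (h1 : 0 < x) (h2 : x < 2) :
    Real.sqrt 3 / Real.sqrt (x ^ 3 + 1) =
      1 / Real.sqrt (((x ^ 3 + 4) / (3 * x ^ 2)) ^ 3 - 1) * |(x ^ 3 - 8) / (3 * x ^ 3)| := by
  have h8 : x ^ 3 < 8 := isoMid_cube_lt_eight h1 h2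
  have h3 : 0 < x ^ 3 + 1 := by positivity
  rw [isoMid_phi_cube_sub_one h1]
  set s := Real.sqrt (x ^ 3 + 1) with hs_def
  set t := Real.sqrt 3 with ht_def
  have hs : 0 < s := Real.sqrt_pos.mpr h3
  have ht : 0 < t := Real.sqrt_pos.mpr (by norm_num)
  have hs0 : s ≠ 0 := hs.ne'
  have ht0 : t ≠ 0 := ht.ne'
  have hx0 : x ≠ 0 := h1.ne'
  have h8' : 0 < 8 - x ^ 3 := sub_pos.mpr h8
  have h80 : 8 - x ^ 3 ≠ 0 := h8'.ne'
  have hq : 0 < s * (8 - x ^ 3) / (3 * t * x ^ 3) := by positivity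
  rw [Real.sqrt_sq hq.le, abs_div, abs_of_neg (by linarith : x ^ 3 - 8 < 0),
    abs_of_pos (by positivity : (0:ℝ) < 3 * x ^ 3)]
  field_simp
  ring

/-- `X` is injective on `(0, 2)`: `(X a − X b)·3a²b² = (a − b)·(a²b² − 4(a + b))` and
`a²b² < 4ab < 4(a + b)` there. [folklore] -/
theorem isoMid_phi_injective {a b : ℝ} (ha1 : 0 < a) (ha2 : a < 2) (hb1 : 0 < b) (hb2 : b < 2)
    (h : (a ^ 3 + 4) / (3 * a ^ 2) = (b ^ 3 + 4) / (3 * b ^ 2)) : a = b := by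
  have hA : (3 * a ^ 2) ≠ 0 := by positivity
  have hB : (3 * b ^ 2) ≠ 0 := by positivity
  rw [div_eq_div_iff hA hB] at h
  have key : (a - b) * (a ^ 2 * b ^ 2 - 4 * (a + b)) = 0 := by
    linear_combination (1 / 3 : ℝ) * h
  have hab0 : 0 < a * b := mul_pos ha1 hb1
  have hab2 : a * b < 2 * b := mul_lt_mul_of_pos_right ha2 hb1
  have hba2 : b * a < 2 * a := mul_lt_mul_of_pos_right hb2 ha1
  have hab4 : a * b < 4 := by linarith
  have h1 : (a * b) * (a * b) < (a * b) * 4 := mul_lt_mul_of_pos_left hab4 hab0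
  have h2 : a * b < a + b := by linarith
  have hK : a ^ 2 * b ^ 2 - 4 * (a + b) ≠ 0 := by
    apply ne_of_lt
    nlinarith
  rcases mul_eq_zero.mp key with h0 | h0
  · linarith
  · exact absurd h0 hK

/-- **Surjectivity**: every `c > 1` is `X x` for some `x ∈ (0, 2)` (intermediate value theorem on
`[1/c, 2]`: `X(1/c) > 4c²/3 > c` and `X(2) = 1`). [folklore] -/
theorem isoMid_exists_phi_eq {c : ℝ} (hc : 1 < c) :
    ∃ x : ℝ, 0 < x ∧ x < 2 ∧ (x ^ 3 + 4) / (3 * x ^ 2) = c := by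
  set Φ : ℝ → ℝ := fun y => (y ^ 3 + 4) / (3 * y ^ 2) with hΦ
  have hc0 : 0 < c := by linarith
  -- the left end point `a = 1/c ∈ (0, 1)`
  set a : ℝ := 1 / c with ha
  have ha0 : 0 < a := by positivity
  have ha1 : a < 1 := by rw [ha, div_lt_one hc0]; exact hc
  have hab : a ≤ 2 := by linarith
  have hca : c * a = 1 := by rw [ha]; field_simp
  have hfa : c < Φ a := by
    show c < (a ^ 3 + 4) / (3 * a ^ 2)
    rw [lt_div_iff₀ (by positivity)]
    have h1 : c * (3 * a ^ 2) = 3 * a := by linear_combination (3 * a) * hca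
    rw [h1]
    have h2 : 0 < a ^ 3 := by positivity
    linarith
  have hf2 : Φ 2 = 1 := by norm_num [hΦ]
  -- intermediate value theorem on `[a, 2] ⊆ (0, 2]`
  have hcont : ContinuousOn Φ (Icc a 2) := fun x hx =>
    (isoPos_hasDerivAt_xMap (by linarith [hx.1] : x ≠ 0)).continuousAt.continuousWithinAt
  obtain ⟨x, hx, hxc⟩ := intermediate_value_Icc' hab hcont ⟨by rw [hf2]; exact hc.le, hfa.le⟩
  have hx2 : x ≠ 2 := by
    rintro rfl
    rw [hf2] at hxc
    linarith
  exact ⟨x, by linarith [hx.1], lt_of_le_of_ne hx.2 hx2, hxc⟩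

/-! ## One rule-2 move along `X` on the arc `(0, 2)` -/

/-- **The 3-isogeny on the arc `(0, 2)` as ONE move.** For any representations
`S = [{0 < p 0 < 2}, √3/√(x³+1)]` and `T = [{1 < p 0}, 1/√(x³−1)]` (integrands prescribed on the
domains only), `KZ.Equivalent S T`: `[S] − [T] ∈ KZ.changeOfVariablesRel` along
`Φ : p ↦ (X(p 0))`, `X(x) = (x³+4)/(3x²)` (`ℚ`-rational and pole-free on the arc, injective there with
derivative `X′(x) = (x³−8)/(3x³)`, `X((0,2)) = (1,∞)`, and `√3/√(x³+1) = (1/√(X³−1))·|X′|`).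
[cite: KontsevichZagier2001, §1.2 rule (2)] -/
theorem stub_isogenyThree_piece_mid : ∀ (S T : KZ.IntegralRep 1),
    S.domain = {x | 0 < x 0 ∧ x 0 < 2} →
    Set.EqOn S.integrand (fun x => Real.sqrt 3 / Real.sqrt (x 0 ^ 3 + 1)) S.domain →
    T.domain = {x | 1 < x 0} →
    Set.EqOn T.integrand (fun x => 1 / Real.sqrt (x 0 ^ 3 - 1)) T.domain →
    KZ.Equivalent S T := by
  intro S T hSd hSi hTd hTi
  set φ : ℝ → ℝ := fun x => (x ^ 3 + 4) / (3 * x ^ 2) with hφ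
  set φ' : ℝ → ℝ := fun x => (x ^ 3 - 8) / (3 * x ^ 3) with hφ'
  have hmem : ∀ p ∈ S.domain, 0 < p 0 ∧ p 0 < 2 := fun p hp => by rwa [hSd] at hp
  refine KZ.changeOfVariablesRel_subset_relations
    (of_sub_of_mem_changeOfVariablesRel_dimOne S T φ φ' ?_
      (fun p hp => isoPos_hasDerivAt_xMap (hmem p hp).1.ne') ?_ ?_ ?_)
  · -- `Φ` is `ℚ`-semialgebraic on the arc (a pole-free quotient of `ℚ`-polynomials)
    refine isSemialgebraicFunOn_ratFun₁ S.isSemialgebraic_domain (X 0 ^ 3 + 4) (3 * X 0 ^ 2) φ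
      (fun x hx => ?_) (fun x _ => ?_)
    · simp only [map_mul, map_pow, MvPolynomial.aeval_X, map_ofNat]
      exact (mul_pos three_pos (pow_pos (hmem x hx).1 2)).ne'
    · simp [hφ]
  · -- injective on the arc
    intro p hp q hq h
    exact isoMid_phi_injective (hmem p hp).1 (hmem p hp).2 (hmem q hq).1 (hmem q hq).2 h
  · -- the image of the arc is `(1, ∞)`
    rw [hTd, hSd]
    ext q
    simp only [mem_setOf_eq, mem_image]
    constructor
    · intro hq
      obtain ⟨x, hx1, hx2, hx⟩ := isoMid_exists_phi_eq hq
      exact ⟨fun _ => x, ⟨hx1, hx2⟩, funext fun i => by rw [Subsingleton.elim i 0]; exact hx⟩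
    · rintro ⟨p, ⟨hp1, hp2⟩, rfl⟩
      exact isoMid_one_lt_phi hp1 hp2
  · -- the Jacobian identity on the arc
    intro p hp
    obtain ⟨hp1, hp2⟩ := hmem p hp
    have hφp : (fun _ : Fin 1 => φ (p 0)) ∈ T.domain := by
      rw [hTd]
      exact isoMid_one_lt_phi hp1 hp2
    rw [hSi hp, hTi hφp]
    exact isoMid_jacobian hp1 hp2

end Summit.KontsevichZagierPeriods.FermatIsogeny.BetaLinearSector.Sixths

end
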